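import Summits.Ventures.DiscreteObjects.Hadamard.CompositeOrder161Row

/-!
# Hadamard 668 census, family F12 — no Hadamard matrix of order 668 has an automorphism of order 161 (kernel)

Framing: lottery ticket; floor = certified bounds/negative ranges.

Cell pub-namedobj (venture DiscreteObjects), target (H), hadamard gen 11 — kernel version of FAMILY-F12-G10 §8(m) (HANDOFF-H-g10
item 0), completing the composite exclusions `115, 161, 253` begun in `CompositeOrder23`.  For a permutation automorphism pair
`(π, κ)` of order `161` of a Hadamard matrix `H` of order `668` (fixed-point-free type forced, `order161_forces_fpf`),
`order161_row_relations` supplies a row `x₀` of the `7`-fixed `23`-orbit and the fixed row `r₀` with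
`∑_{Y} H x₀ j · T(j) = 644` and `∑_{Y} H r₀ j · H x₀ j = 0` over the `644` columns `Y` moved by `κ^23`
(`T(j) = ∑_{s<23} H x₀ (κ^{7s} j)`).  Here: `κ` acts FREELY on `Y` with `κ^161 = 1` (a fixed point of `κ^k` on `Y` would be
fixed by `κ^23` or equal to the `κ^7`-fixed column), so `Y` is the disjoint union of four `⟨κ⟩`-orbits `O₁..O₄` of length `161`
(`FreeOrbits`); `T` and `E = H r₀ ·` are `κ`-invariant (`κ = κ^70 κ^92`), hence constant on each orbit, and
`23 · ∑_{O_i} H x₀ = 161 · T_i`; so `7 ∑ T_i² = 644` and `7 ∑ E_i T_i = 0` with `T_i` odd, `E_i = ±1`: four odd integers with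
sum `0` and squares summing to `92` — impossible, since `a+b+c+d = 0` gives `a²+b²+c²+d² = 4(x²+y²+z²)` with
`x, y, z = (a+b)/2, (b+c)/2, (c+a)/2` and `23 ≡ 7 (mod 8)` is not a sum of three squares (`four_odd_sq_ne_92`).
Results: **`no_hadamard668_signedAut_order161`** (signed automorphisms `(π, κ, d, e)` with `π^161 = κ^161 = 1`, both parts
nontrivial), `no_hadamard668_signedAut_orderOf_161`, and the summary **`hadamard668_signedAut_orderOf_not_mem`**:
the permutation pair of a signed automorphism of a Hadamard matrix of order `668` never has order `115`, `161` or `253`.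
Ours, not literature; no `sorry`; `decide` only over `(ZMod 8)³`.
-/

namespace Summit.Ventures.DiscreteObjects.Hadamard

open Finset BigOperators Matrix

open Literature.Combinatorics.Designs.GoethalsSeidel (IsHadamardMatrix)

variable {ι : Type*} [Fintype ι] [DecidableEq ι]

section arithmetic

/-- `23 ≡ 7 (mod 8)` is not a sum of three squares -/
lemma three_sq_ne_23 (x y z : ℤ) : x ^ 2 + y ^ 2 + z ^ 2 ≠ 23 := by
  intro h
  have h8 : ∀ X Y Z : ZMod 8, X ^ 2 + Y ^ 2 + Z ^ 2 ≠ 23 := by decide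
  apply h8 x y z
  have := congrArg (Int.cast : ℤ → ZMod 8) h
  push_cast at this
  exact this

/-- four odd integers with sum `0` do not have squares summing to `92` -/
lemma four_odd_sq_ne_92 (a b c d : ℤ) (ha : Odd a) (hb : Odd b) (hc : Odd c) (hsum : a + b + c + d = 0)
    (hsq : a ^ 2 + b ^ 2 + c ^ 2 + d ^ 2 = 92) : False := by
  obtain ⟨a', rfl⟩ := ha
  obtain ⟨b', rfl⟩ := hb
  obtain ⟨c', rfl⟩ := hc
  have hd : d = -(2 * a' + 1) - (2 * b' + 1) - (2 * c' + 1) := by linarith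
  rw [hd] at hsq
  have h4 : 4 * ((a' + b' + 1) ^ 2 + (b' + c' + 1) ^ 2 + (c' + a' + 1) ^ 2) = 4 * 23 := by
    linear_combination hsq
  exact three_sq_ne_23 (a' + b' + 1) (b' + c' + 1) (c' + a' + 1) (by linarith)

end arithmetic

omit [Fintype ι] [DecidableEq ι] in
/-- a `σ`-invariant function is invariant under every power of `σ` -/
lemma apply_pow_of_invariant {f : ι → ℤ} {σ : Equiv.Perm ι} (h : ∀ y, f (σ y) = f y) (k : ℕ) (y : ι) :
    f ((σ ^ k) y) = f y := by
  induction k generalizing y with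
  | zero => simp
  | succ k ih => rw [pow_succ', Equiv.Perm.mul_apply, h, ih]

section main
variable {H : Matrix ι ι ℤ} {π κ : Equiv.Perm ι}

/-- **Order 161 (= 7 · 23), unsigned form: impossible.** -/
theorem no_unsignedAut_order161 (hH : IsHadamardMatrix H) (hι : Fintype.card ι = 668)
    (hA : ∀ i j, H (π i) (κ j) = H i j) (hπ : π ^ 161 = 1) (hκ : κ ^ 161 = 1)
    (hσ : π ^ 7 ≠ 1 ∨ κ ^ 7 ≠ 1) (hh : π ^ 23 ≠ 1 ∨ κ ^ 23 ≠ 1) : False := by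
  obtain ⟨c₀, r₀, x₀, -, hc₀h, hc₀uniq, hr₀fix, hr₀h, -, hx₀h, f24c, hN1, hN2⟩ :=
    order161_row_relations hH hι hA hπ hκ hσ hh
  have hκ7 : (κ ^ 7) ^ 23 = 1 := by rw [← pow_mul]; exact hκ
  have hκ23 : (κ ^ 23) ^ 7 = 1 := by rw [← pow_mul]; exact hκ
  have hA7 : ∀ i j, H ((π ^ 7) i) ((κ ^ 7) j) = H i j := aut_pow_apply (fun i j => H i j) π κ hA 7
  have hA23 : ∀ i j, H ((π ^ 23) i) ((κ ^ 23) j) = H i j := aut_pow_apply (fun i j => H i j) π κ hA 23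
  -- the three functions on columns
  set u : ι → ℤ := fun j => H x₀ j with hu
  set E : ι → ℤ := fun j => H r₀ j with hE
  set T : ι → ℤ := fun j => ∑ s ∈ Finset.range 23, H x₀ (((κ ^ 7) ^ s) j) with hT
  -- invariances
  have hu23 : ∀ y, H x₀ ((κ ^ 23) y) = H x₀ y := by
    intro y; conv_lhs => rw [← hx₀h]
    exact hA23 x₀ y
  have hE23 : ∀ y, E ((κ ^ 23) y) = E y := by
    intro y; simp only [hE]; conv_lhs => rw [← hr₀h]
    exact hA23 r₀ y
  have hE7 : ∀ y, E ((κ ^ 7) y) = E y := by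
    intro y; simp only [hE]; conv_lhs => rw [← hr₀fix]
    exact hA7 r₀ y
  have hT7 : ∀ y, T ((κ ^ 7) y) = T y := by
    intro y
    simp only [hT]
    have e : ∀ s, ((κ ^ 7) ^ s) ((κ ^ 7) y) = ((κ ^ 7) ^ (s + 1)) y := by
      intro s; rw [pow_succ (κ ^ 7) s, Equiv.Perm.mul_apply]
    simp only [e]
    rw [Finset.sum_range_succ (fun s => H x₀ (((κ ^ 7) ^ (s + 1)) y)) 22,
      Finset.sum_range_succ' (fun s => H x₀ (((κ ^ 7) ^ s) y)) 22, hκ7, pow_zero]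
  have hT23 : ∀ y, T ((κ ^ 23) y) = T y := by
    intro y
    simp only [hT]
    apply Finset.sum_congr rfl
    intro s _
    rw [← pow_pow_comm_apply κ 23 7 s y, hu23]
  have hκ162 : ∀ y, κ y = ((κ ^ 7) ^ 10) (((κ ^ 23) ^ 4) y) := by
    intro y
    rw [← pow_mul, ← pow_mul, ← Equiv.Perm.mul_apply, ← pow_add,
      show 7 * 10 + 23 * 4 = 161 + 1 from rfl, pow_succ, hκ, one_mul]
  have hTκ : ∀ y, T (κ y) = T y := by
    intro y; rw [hκ162 y, apply_pow_of_invariant hT7, apply_pow_of_invariant hT23]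
  have hEκ : ∀ y, E (κ y) = E y := by
    intro y; rw [hκ162 y, apply_pow_of_invariant hE7, apply_pow_of_invariant hE23]
  -- the moved columns Y of κ^23: κ acts freely with κ^161 = 1
  set Y := univ.filter (fun j => ¬ (κ ^ 23) j = j) with hY
  have hYcard : Y.card = 644 := by
    have := Finset.card_filter_add_card_filter_not (s := (univ : Finset ι)) (fun j => (κ ^ 23) j = j)
    rw [Finset.card_univ, hι, f24c] at this
    simp only [hY]
    omega
  have hYstab : ∀ y ∈ Y, κ y ∈ Y := by
    intro y hy
    simp only [hY, Finset.mem_filter, Finset.mem_univ, true_and] at hy ⊢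
    rw [pow_apply_comm κ 23 y]
    exact fun h => hy (κ.injective h)
  have hYfree : ∀ y ∈ Y, ∀ k, 0 < k → k < 161 → (κ ^ k) y ≠ y := by
    intro y hy k hk0 hk hfix
    have hy' : ¬ (κ ^ 23) y = y := by simpa [hY] using hy
    by_cases h7 : 7 ∣ k
    · obtain ⟨k', rfl⟩ := h7
      have h1 : ((κ ^ 7) ^ k') y = y := by rw [← pow_mul]; exact hfix
      have hcop : Nat.Coprime k' 23 :=
        Nat.Coprime.symm ((Nat.Prime.coprime_iff_not_dvd (by norm_num)).mpr (by omega))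
      have h2 : ((κ ^ 7) ^ 23) y = y := by rw [hκ7]; rfl
      have h3 := perm_fixed_of_pow_coprime (κ ^ 7) hcop (by norm_num) h1 h2
      rw [hc₀uniq y h3] at hy'
      exact hy' hc₀h
    · have h1 : ((κ ^ 23) ^ k) y = y := by
        rw [← pow_mul, mul_comm, pow_mul]; exact perm_pow_apply_of_fixed _ hfix 23
      have hcop : Nat.Coprime k 7 := Nat.Coprime.symm ((Nat.Prime.coprime_iff_not_dvd (by norm_num)).mpr h7)
      have h2 : ((κ ^ 23) ^ 7) y = y := by rw [hκ23]; rfl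
      exact hy' (perm_fixed_of_pow_coprime (κ ^ 23) hcop (by norm_num) h1 h2)
  -- per-orbit identities
  have hP1 : ∀ j ∈ Y, ∑ x ∈ orbFin κ 161 j, u x * T x = T j * ∑ k ∈ Finset.range 161, u ((κ ^ k) j) := by
    intro j hj
    rw [sum_orbFin_of_free (hYfree j hj), Finset.mul_sum]
    apply Finset.sum_congr rfl
    intro k _
    rw [apply_pow_of_invariant hTκ k j]; ring
  have hP2 : ∀ j ∈ Y, ∑ x ∈ orbFin κ 161 j, E x * u x = E j * ∑ k ∈ Finset.range 161, u ((κ ^ k) j) := by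
    intro j hj
    rw [sum_orbFin_of_free (hYfree j hj), Finset.mul_sum]
    apply Finset.sum_congr rfl
    intro k _
    rw [apply_pow_of_invariant hEκ k j]
  have hP3 : ∀ j ∈ Y, ∑ k ∈ Finset.range 161, u ((κ ^ k) j) = 7 * T j := by
    intro j hj
    have h1 : ∑ x ∈ orbFin κ 161 j, T x = 161 * T j := by
      rw [sum_orbFin_of_invariant (hYfree j hj) T hTκ]; norm_num
    have e : ∀ s : ℕ, ∑ x ∈ orbFin κ 161 j, H x₀ (((κ ^ 7) ^ s) x) = ∑ x ∈ orbFin κ 161 j, H x₀ x := by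
      intro s
      rw [← pow_mul]
      exact sum_orbFin_comp_pow (by norm_num) hκ j (7 * s) (fun x => H x₀ x)
    have h2 : ∑ x ∈ orbFin κ 161 j, T x = 23 * ∑ x ∈ orbFin κ 161 j, u x := by
      simp only [hT, hu]
      rw [Finset.sum_comm, Finset.sum_congr rfl fun s _ => e s, Finset.sum_const, Finset.card_range, nsmul_eq_mul]
      norm_num
    have hSO : ∑ x ∈ orbFin κ 161 j, u x = ∑ k ∈ Finset.range 161, u ((κ ^ k) j) :=
      sum_orbFin_of_free (hYfree j hj) u
    linarith
  -- four orbit representatives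
  have hO_sub : ∀ j ∈ Y, orbFin κ 161 j ⊆ Y := fun j hj => orbFin_subset_of_stable Y hYstab hj
  have hO_card : ∀ j ∈ Y, (orbFin κ 161 j).card = 161 := fun j hj => card_orbFin_of_free (hYfree j hj)
  have hO_disj : ∀ j ∈ Y, ∀ j' ∈ Y, j' ∉ orbFin κ 161 j → Disjoint (orbFin κ 161 j) (orbFin κ 161 j') :=
    fun j hj j' hj' hn => disjoint_orbFin_of_not_mem (by norm_num) hκ (hYfree j hj) (hYfree j' hj')
      (fun y hy => hYfree y (hO_sub j hj hy)) hn
  have pick : ∀ A : Finset ι, A ⊆ Y → A.card < 644 → ∃ j, j ∈ Y ∧ j ∉ A := by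
    intro A hA hlt
    have hne : (Y \ A).Nonempty := by
      rw [← Finset.card_pos]
      have := Finset.card_sdiff_add_card_eq_card hA
      omega
    obtain ⟨j, hj⟩ := hne
    exact ⟨j, (Finset.mem_sdiff.mp hj).1, (Finset.mem_sdiff.mp hj).2⟩
  obtain ⟨j₁, hj₁, -⟩ := pick ∅ (Finset.empty_subset _) (by simp)
  obtain ⟨j₂, hj₂, hn₂⟩ := pick (orbFin κ 161 j₁) (hO_sub j₁ hj₁) (by rw [hO_card j₁ hj₁]; norm_num)
  have hd12 := hO_disj j₁ hj₁ j₂ hj₂ hn₂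
  have hU2sub : orbFin κ 161 j₁ ∪ orbFin κ 161 j₂ ⊆ Y := Finset.union_subset (hO_sub j₁ hj₁) (hO_sub j₂ hj₂)
  have hU2card : (orbFin κ 161 j₁ ∪ orbFin κ 161 j₂).card = 322 := by
    rw [Finset.card_union_of_disjoint hd12, hO_card j₁ hj₁, hO_card j₂ hj₂]
  obtain ⟨j₃, hj₃, hn₃⟩ := pick _ hU2sub (by rw [hU2card]; norm_num)
  rw [Finset.mem_union, not_or] at hn₃
  have hd13 := hO_disj j₁ hj₁ j₃ hj₃ hn₃.1
  have hd23 := hO_disj j₂ hj₂ j₃ hj₃ hn₃.2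
  have hd12_3 : Disjoint (orbFin κ 161 j₁ ∪ orbFin κ 161 j₂) (orbFin κ 161 j₃) :=
    Finset.disjoint_union_left.mpr ⟨hd13, hd23⟩
  have hU3sub : orbFin κ 161 j₁ ∪ orbFin κ 161 j₂ ∪ orbFin κ 161 j₃ ⊆ Y := Finset.union_subset hU2sub (hO_sub j₃ hj₃)
  have hU3card : (orbFin κ 161 j₁ ∪ orbFin κ 161 j₂ ∪ orbFin κ 161 j₃).card = 483 := by
    rw [Finset.card_union_of_disjoint hd12_3, hU2card, hO_card j₃ hj₃]
  obtain ⟨j₄, hj₄, hn₄⟩ := pick _ hU3sub (by rw [hU3card]; norm_num)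
  rw [Finset.mem_union, Finset.mem_union, not_or, not_or] at hn₄
  have hd14 := hO_disj j₁ hj₁ j₄ hj₄ hn₄.1.1
  have hd24 := hO_disj j₂ hj₂ j₄ hj₄ hn₄.1.2
  have hd34 := hO_disj j₃ hj₃ j₄ hj₄ hn₄.2
  have hd123_4 : Disjoint (orbFin κ 161 j₁ ∪ orbFin κ 161 j₂ ∪ orbFin κ 161 j₃) (orbFin κ 161 j₄) :=
    Finset.disjoint_union_left.mpr ⟨Finset.disjoint_union_left.mpr ⟨hd14, hd24⟩, hd34⟩
  have hU4sub : orbFin κ 161 j₁ ∪ orbFin κ 161 j₂ ∪ orbFin κ 161 j₃ ∪ orbFin κ 161 j₄ ⊆ Y :=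
    Finset.union_subset hU3sub (hO_sub j₄ hj₄)
  have hU4card : (orbFin κ 161 j₁ ∪ orbFin κ 161 j₂ ∪ orbFin κ 161 j₃ ∪ orbFin κ 161 j₄).card = 644 := by
    rw [Finset.card_union_of_disjoint hd123_4, hU3card, hO_card j₄ hj₄]
  have hUeq : orbFin κ 161 j₁ ∪ orbFin κ 161 j₂ ∪ orbFin κ 161 j₃ ∪ orbFin κ 161 j₄ = Y :=
    Finset.eq_of_subset_of_card_le hU4sub (by rw [hYcard, hU4card])
  have hsplit : ∀ F : ι → ℤ, ∑ j ∈ Y, F j = ∑ j ∈ orbFin κ 161 j₁, F j + ∑ j ∈ orbFin κ 161 j₂, F j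
      + ∑ j ∈ orbFin κ 161 j₃, F j + ∑ j ∈ orbFin κ 161 j₄, F j := by
    intro F
    rw [← hUeq, Finset.sum_union hd123_4, Finset.sum_union hd12_3, Finset.sum_union hd12]
  -- the two relations on the four orbits
  have e1 : T j₁ * (7 * T j₁) + T j₂ * (7 * T j₂) + T j₃ * (7 * T j₃) + T j₄ * (7 * T j₄) = 644 := by
    have h := hN1
    rw [hsplit (fun j => u j * T j), hP1 j₁ hj₁, hP1 j₂ hj₂, hP1 j₃ hj₃, hP1 j₄ hj₄,
      hP3 j₁ hj₁, hP3 j₂ hj₂, hP3 j₃ hj₃, hP3 j₄ hj₄] at h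
    exact h
  have e2 : E j₁ * (7 * T j₁) + E j₂ * (7 * T j₂) + E j₃ * (7 * T j₃) + E j₄ * (7 * T j₄) = 0 := by
    have h := hN2
    rw [hsplit (fun j => E j * u j), hP2 j₁ hj₁, hP2 j₂ hj₂, hP2 j₃ hj₃, hP2 j₄ hj₄,
      hP3 j₁ hj₁, hP3 j₂ hj₂, hP3 j₃ hj₃, hP3 j₄ hj₄] at h
    exact h
  -- parity of T and signs of E
  have hTodd : ∀ j, Odd (T j) := by
    intro j
    have h2 := two_dvd_sum_pm_sub_card (Finset.range 23) (fun s => H x₀ (((κ ^ 7) ^ s) j)) (fun s _ => hH.1 x₀ _)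
    rw [Finset.card_range] at h2
    obtain ⟨t, ht⟩ := h2
    simp only [Nat.cast_ofNat] at ht
    exact ⟨t + 11, by simp only [hT]; linarith⟩
  have hEpm : ∀ j, E j = 1 ∨ E j = -1 := fun j => hH.1 r₀ j
  have hvodd : ∀ j, Odd (E j * T j) := by
    intro j
    rcases hEpm j with h | h
    · rw [h, one_mul]; exact hTodd j
    · rw [h, neg_one_mul]; exact (hTodd j).neg
  have hvsq : ∀ j, (E j * T j) ^ 2 = T j ^ 2 := by
    intro j; rcases hEpm j with h | h <;> rw [h] <;> ring
  have hsq : T j₁ ^ 2 + T j₂ ^ 2 + T j₃ ^ 2 + T j₄ ^ 2 = 92 := by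
    have : 7 * (T j₁ ^ 2 + T j₂ ^ 2 + T j₃ ^ 2 + T j₄ ^ 2) = 7 * 92 := by linear_combination e1
    linarith
  have hlin : E j₁ * T j₁ + E j₂ * T j₂ + E j₃ * T j₃ + E j₄ * T j₄ = 0 := by
    have : 7 * (E j₁ * T j₁ + E j₂ * T j₂ + E j₃ * T j₃ + E j₄ * T j₄) = 7 * 0 := by linear_combination e2
    linarith
  exact four_odd_sq_ne_92 (E j₁ * T j₁) (E j₂ * T j₂) (E j₃ * T j₃) (E j₄ * T j₄) (hvodd j₁) (hvodd j₂) (hvodd j₃)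
    hlin (by rw [hvsq, hvsq, hvsq, hvsq]; exact hsq)

/-- **No Hadamard matrix of order 668 has a signed automorphism `(π, κ, d, e)` whose permutation pair has order `161`:**
`π^161 = κ^161 = 1` with `(π^7, κ^7) ≠ (1, 1)` and `(π^23, κ^23) ≠ (1, 1)` is impossible. -/
theorem no_hadamard668_signedAut_order161 (hH : IsHadamardMatrix H) (hι : Fintype.card ι = 668)
    (π κ : Equiv.Perm ι) (d e : ι → ℤ) (haut : IsSignedAut H π κ d e) (hπ : π ^ 161 = 1) (hκ : κ ^ 161 = 1)
    (hσ : π ^ 7 ≠ 1 ∨ κ ^ 7 ≠ 1) (hh : π ^ 23 ≠ 1 ∨ κ ^ 23 ≠ 1) : False := by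
  obtain ⟨H', hH', hA⟩ := exists_unsigned_of_signedAut hH haut (by decide : Odd 161) hπ hκ
  exact no_unsignedAut_order161 hH' hι hA hπ hκ hσ hh

/-- **Order form.**  No Hadamard matrix of order `668` has a signed automorphism whose permutation pair `(π, κ)` has
order `161` in `Perm × Perm`. -/
theorem no_hadamard668_signedAut_orderOf_161 (hH : IsHadamardMatrix H) (hι : Fintype.card ι = 668)
    (π κ : Equiv.Perm ι) (d e : ι → ℤ) (haut : IsSignedAut H π κ d e)
    (h : orderOf ((π, κ) : Equiv.Perm ι × Equiv.Perm ι) = 161) : False := by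
  obtain ⟨hπ, hκ, hσ⟩ := pow_data_of_orderOf h (a := 7) (by norm_num) (by norm_num)
  obtain ⟨-, -, hh⟩ := pow_data_of_orderOf h (a := 23) (by norm_num) (by norm_num)
  exact no_hadamard668_signedAut_order161 hH hι π κ d e haut hπ hκ hσ hh

/-- **Summary: the composite orders `115 = 5·23`, `161 = 7·23`, `253 = 11·23` do not occur.**  For every signed-permutation
automorphism `(π, κ, d, e)` of a Hadamard matrix of order `668`, the order of the permutation pair `(π, κ)` is none of
`115, 161, 253`. -/
theorem hadamard668_signedAut_orderOf_not_mem (hH : IsHadamardMatrix H) (hι : Fintype.card ι = 668)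
    (π κ : Equiv.Perm ι) (d e : ι → ℤ) (haut : IsSignedAut H π κ d e) :
    orderOf ((π, κ) : Equiv.Perm ι × Equiv.Perm ι) ∉ ({115, 161, 253} : Finset ℕ) := by
  intro hmem
  simp only [Finset.mem_insert, Finset.mem_singleton] at hmem
  rcases hmem with h | h | h
  · exact no_hadamard668_signedAut_orderOf_115 hH hι π κ d e haut h
  · exact no_hadamard668_signedAut_orderOf_161 hH hι π κ d e haut h
  · exact no_hadamard668_signedAut_orderOf_253 hH hι π κ d e haut h

end main

end Summit.Ventures.DiscreteObjects.Hadamard
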